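import Summits.BirchSwinnertonDyer.BirchSwinnertonDyer.Theorems.SchneiderFreeAdditiveX3UpperGordCellThreeAnomalousOfPartnerClassTree
import Summits.BirchSwinnertonDyer.BirchSwinnertonDyer.Theorems.SchneiderFreeAdditiveX3GordCellPerPairNAT
import HarnessLib

/-!
# Route `SchneiderFreeAdditiveX3` (K1 door) / wing `…Upper`: the UPPER half per pair on the (G-ord, `e = 2`) cell AT `p = 3` for the NON-ANOMALOUS twists WITHOUT
# CGLS 2022 Prop. 14 — [INV.μ] at the Heegner datum from the NAT index road (FILE D §2) fed by AUX3-NAT (FILE E1) — and the BOTH-halves per-pair records at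
# `p = 3` with NO CGLS §1.2 statement at all (FILE E7 of generation 43)

Cell `bsd-schneider-ideate`, seat `bsd-schneider-door-c5` (prover, generation 43; assembly layer; `--supports` 19177; FYI wing 20365).  PARTITION: board row
B6 ∩ X3 ∩ sst-twist, `r = 1`, (G-ord, `e = 2`) half at `p = 3` (2 411 of 2 560 census pairs; the 686 NON-anomalous ones are re-keyed here) of
`Rank1Residual.partition` — ASSEMBLY; types-the-object-of nothing new; closes none of B6's cells (BSD NOT advanced).  bears_on: K1-door (19177 r3), wing (20365 r3).

WHY.  After FILES A–E6 the LOWER half per pair at `p = 3` displays no CGLS §1.2 statement, but the BOTH-halves records (`KYBranchPerPairNAT.missingPPartAt_gordTwo_three_of_twistUnitAt`)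
still carry `hprop125`: the UPPER half for a NON-anomalous twist (generation 25's `UpperOfPrintNonAnomalousTwist.additiveIMCUpperBDPInputManinAtField_…_of_prop14_…_of_forall_twist`)
takes «`X_ac^∅(W_K)` is `Λ`-torsion with `μ = 0`» from CGLS Prop. 14 (`KYNonAnomalousTwist.isTorsion_muInvariant_eq_zero_empty_of_prop14_…`, fed by
`prop14_residualCharacterSelmer_finite_of_fact hprop125`).  That clause is exactly what FILE D §2 (`NATLambdaAlgebraicSide.xAc_clauses_of_primitive_clauses`) returns from the
PRIMITIVE unramified clauses of the residual pair, and AUX3-NAT (FILE E1 `NATKYBranchThree.exists_aux3nat_of_thm212`) supplies those clauses at every conjugate prime /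
embedding datum — precisely the data in scope inside the upper socket's ♭-frame callback.  So the `p = 3` NAT upper half runs on {CGLS Thm. 2.1.2, Bleher et al. 3.3.1,
de Shalit II.6.4, Hida Thm. I} (already displayed by the anomalous branch and by the lower half) instead of CGLS Prop. 14 / Prop. 1.2.5.

WHAT.
* §1 `additiveIMCUpperBDPInputManinAtField_three_of_aux3nat` — the field-local (G-ord, `e = 2`) co-socket at `p = 3`, `d_K ≠ −3`, under `NAT(W, 3)`: generation 25's
  theorem VERBATIM except that `hT, hμX` come from AUX3-NAT + FILE D §2 inside the callback (binders `h212 h331 hFE hO1` replace `h14`).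
* §2 `missingUpperBoundAt_gordTwo_three_of_printedFacts_of_twistUnitAt_of_forall_twist_of_aux3nat` — the UPPER half per pair at `p = 3` under NAT (generation 25's §4
  wrapper on §1); §3 `missingUpperBoundAt_gordTwo_three_of_printedFacts_of_twistUnitAt_noCGLS` — the whole (G-ord, `e = 2`) cell at `p = 3` (NAT branch §2, anomalous
  branch = `UpperThreeAnomalousOfPartnerClassTree.…_of_partnerClass_of_tree`, unchanged): NO CGLS §1.2 binder.
* §4 the BOTH-halves per-pair records at `p = 3` WITHOUT `hprop125` (`missingPPartAt_gordTwo_three_of_twistUnitAt`, `bsdp_gordTwo_three_of_twistUnitAt`: lower = FILE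
  E6, upper = §3).  (The every-odd-`p` forms keep FILE E6's statements — `hprop125` is needed at `p ≥ 5` anyway — so they are not restated here.)
INPUT LEDGER of the `p = 3` BOTH-halves per-pair record after this file: `PrintedFacts` ∪ {Hsieh A, LZZ, Castella–Hsieh signed} ∪ {[DIV.dvd] PRE, [AN3] (two forms),
CGLS Thm 2.1.2} ∪ {Bleher et al. 3.3.1, de Shalit II.6.4, Hida Thm I} ∪ {the pair's TU datum} — NO CGLS §1.2 statement (F48e: + Prop 1.2.5, Prop 14, Cor 1.2.6 (i)(ii)).

HONEST FRAMING: compositions of tree theorems, CONDITIONAL BY NAME on the displayed statements; `BSDp W 3` here is BSD₃ MODULO those statements and the pair's TU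
datum — NOT a proof of BSD for any curve; no definition, no named fact, no `sorry`; nothing is closed; «closes rung: none».  References: [KellerYin2024b] Thm. 3.3.6,
Prop. 3.4.4, §3.5, Thm. 3.5.1; [KellerYin2024] Thm. 1.4.1 (iii), Lemma 5.1.1; [CastellaGrossiLeeSkinner2022] Thms. 1.2.2, 2.1.2, 2.2.2; [BleherEtAl2020] Thm. 3.3.1;
[deShalit1987] II.6.4; [Hida2010MuInvariant] Thm. I; [CastellaHsieh2018] §3.3, Def. 3.7, Prop. 3.8; [Hsieh2014] Thm. A; [LiuZhangZhang2018] Thms. 1.5.1/1.5.3;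
[Miller2011LMS] Def. 1.1; [JetchevSkinnerWan2017] §7.4.1; this seat p676517 (gen 25, the template), F47g (gen 41), F49 (gen 43).
-/

set_option autoImplicit false
set_option linter.dupNamespace false -- the summit namespace `…BirchSwinnertonDyer.BirchSwinnertonDyer.Theorems` (Sub = Summit, D-0017) trips it

noncomputable section

open scoped Classical NumberField

open Field NumberField IsDedekindDomain WeierstrassCurve PowerSeries
  Literature.NumberTheory.EllipticCurves Literature.NumberTheory.EllipticCurves.GreenbergSelmer
  Literature.NumberTheory.GaloisRepresentations Literature.NumberTheory.GaloisCohomology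
  Literature.NumberTheory.EllipticCurves.ModularForms Literature.NumberTheory.EllipticCurves.Rank1Residual
  Literature.NumberTheory.EllipticCurves.Rank1Residual.Typed
  Literature.NumberTheory.EllipticCurves.IwasawaAlgebra
  Literature.NumberTheory.EllipticCurves.KellerYin2024 Literature.NumberTheory.EllipticCurves.CaiShuTian2014
  Summit.BirchSwinnertonDyer.Rank1Residual Summit.BirchSwinnertonDyer.Rank1Residual.Additive
  Summit.BirchSwinnertonDyer.Rank1Residual.X11b
  Summit.BirchSwinnertonDyer.Rank1Residual.X11b.AcSelmer Summit.BirchSwinnertonDyer.Rank1Residual.X11b.Halves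
  Summit.BirchSwinnertonDyer.Rank1Residual.X11b.CongruenceLimit
  Summit.BirchSwinnertonDyer.BirchSwinnertonDyer.Theorems
  Summit.BirchSwinnertonDyer.BirchSwinnertonDyer.Theorems.SchneiderFree
  Summit.BirchSwinnertonDyer.BirchSwinnertonDyer.Theorems.SchneiderFree.Upper
  Summit.BirchSwinnertonDyer.BirchSwinnertonDyer.Theorems.SchneiderFree.KYRead
  Summit.BirchSwinnertonDyer.BirchSwinnertonDyer.Theorems.SchneiderFreeAdditiveX3
  Summit.BirchSwinnertonDyer.BirchSwinnertonDyer.Theorems.SchneiderFreeAdditiveX3.LZZMatch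
  Summit.BirchSwinnertonDyer.BirchSwinnertonDyer.Theorems.SchneiderFreeAdditiveX3.ControlDischarged
  Summit.BirchSwinnertonDyer.BirchSwinnertonDyer.Theorems.SchneiderFreeAdditiveX3.KYBranchOnly
  Summit.BirchSwinnertonDyer.BirchSwinnertonDyer.Theorems.SchneiderFreeAdditiveX3.KYBranchHalves
  Summit.BirchSwinnertonDyer.BirchSwinnertonDyer.Theorems.SchneiderFreeAdditiveX3.KYMuZeroOfPrint
  Summit.BirchSwinnertonDyer.BirchSwinnertonDyer.Theorems.SchneiderFreeAdditiveX3.UpperOfPrint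
  Summit.BirchSwinnertonDyer.BirchSwinnertonDyer.Theorems.SchneiderFreeAdditiveX3.UpperOfPrintDvd
  Summit.BirchSwinnertonDyer.BirchSwinnertonDyer.Theorems.SchneiderFreeAdditiveX3.UpperOfPrintNonAnomalousTwist
  Summit.BirchSwinnertonDyer.BirchSwinnertonDyer.Theorems.SchneiderFreeAdditiveX3.KYNonAnomalousTwist
  Summit.BirchSwinnertonDyer.BirchSwinnertonDyer.Theorems.SchneiderFreeAdditiveX3.UpperThreeAnomalousOfPartnerClass
  Summit.BirchSwinnertonDyer.BirchSwinnertonDyer.Theorems.EisensteinPrimesMuLambda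

open Literature.NumberTheory.EllipticCurves.BCGKPST2020 Literature.NumberTheory.EllipticCurves.DeShalit1987
  Literature.NumberTheory.EllipticCurves.Hida2010MuInvariant
open Literature.NumberTheory.EllipticCurves.CastellaGrossiLeeSkinner2022
  (prop14_residualCharacterSelmer_finite thm212_exists_isKatzLFunction)
open Literature.NumberTheory.EllipticCurves.KellerYin2024 (thm351_anacong_branch_three_allTwists)
open Summit.BirchSwinnertonDyer.BirchSwinnertonDyer.Theorems.TeichmullerPairUnramifiedAtMult (prop14_residualCharacterSelmer_finite_of_fact)
open Summit.BirchSwinnertonDyer.BirchSwinnertonDyer.Theses.SchneiderFreeAdditiveX3 (PrintedFacts)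
open Summit.BirchSwinnertonDyer.BirchSwinnertonDyer.Theorems.SchneiderFreeAdditiveX3.UpperThreeAnomalousOfPartnerClass

namespace Summit.BirchSwinnertonDyer.BirchSwinnertonDyer.Theorems.SchneiderFreeAdditiveX3.UpperGordCellThreeNAT

/-! ### §1 The field-local (G-ord, `e = 2`) co-socket at `p = 3` under NAT, CGLS-Prop-14-free -/

/-- **The field-local (G-ord, `e = 2`) co-socket `AdditiveIMCUpperBDPInputManinAtField W 3 K` at `d_K ≠ −3`, under `NAT(W, 3)`, ⇐ Kolyvagin ∧ modularity ∧ Hsieh 2014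
Thm. A ∧ LZZ 2018 ∧ Castella–Hsieh signed ∧ [DIV.dvd] (PREPRINT) ∧ CGLS Thm. 2.1.2 ∧ Bleher et al. 3.3.1 ∧ de Shalit II.6.4 ∧ Hida Thm. I — NO CGLS Prop. 14.**  Generation 25's
`UpperOfPrintNonAnomalousTwist.additiveIMCUpperBDPInputManinAtField_…_of_prop14_…_of_forall_twist` VERBATIM except that «`𝔛 = X_ac^∅(W_K)` torsion with `μ = 0`» at
the Heegner datum is produced INSIDE the ♭-frame callback: AUX3-NAT (`NATKYBranchThree.exists_aux3nat_of_thm212`) gives the residual pair with the primitive unramified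
clauses of both members at `𝔭`, and FILE D §2 (`NATLambdaAlgebraicSide.xAc_clauses_of_primitive_clauses`, the bad-place shift + Keller–Yin Lemma 5.1.1 dévissage +
Greenberg's criterion) turns them into the clause.  CONDITIONAL; nothing asserted about BSD.
[cite: KellerYin2024b, Thm. 3.3.6 and Prop. 3.4.4, divisibility clause (arXiv:2410.23241 p. 19) (preprint; hypothesis)] [cite: KellerYin2024, Lemma 5.1.1, Thm. 1.4.1]
[cite: CastellaGrossiLeeSkinner2022, Thm. 2.1.2] [cite: BleherEtAl2020, §3.3 Thm. 3.3.1] [cite: deShalit1987, II.6.4] [cite: Hida2010MuInvariant, Thm. I]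
[cite: CastellaHsieh2018, §3.3, Def. 3.7 and Prop. 3.8] [cite: Hsieh2014, Thm. A p. 712] [cite: LiuZhangZhang2018, Thm 1.5.1 and Thm 1.5.3] -/
theorem additiveIMCUpperBDPInputManinAtField_three_of_aux3nat
    (hKo : ∀ (N : ℕ) [NeZero N] (W : WeierstrassCurve ℚ) (K : Type) [Field K] [NumberField K],
      Literature.NumberTheory.EllipticCurves.kolyvagin N W K)
    (hPar : nonempty_modularParametrizationData)
    (hA : Hsieh2014.thmA_exists_isHsiehLFunction_unrPeriod_anyLevel)
    (hL : LiuZhangZhang2018.thm151_thm153_modularCurve_heegnerVector_additive)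
    (hdvd : thm336_dvd_branch_OPEN) (hCHσ : castellaHsieh2018_exists_isBranchBDPLFunction_signed)
    (h212 : thm212_exists_isKatzLFunction) (h331 : thm331_rubin_exists_katzMeasure₂_pseudoIso_span_eq)
    (hFE : thmII64_katzMeasure₂_functionalEquation) (hO1 : thmI_mu_katzBranch_reflect_eq_zero)
    {W : WeierstrassCurve ℚ} [W.IsElliptic] [W.IsGloballyMinimal]
    (hX : ClassX3 W 3) (hSG : Additive.SubGordTwo W 3)
    (htw : ∀ (V : WeierstrassCurve ℚ) [V.IsElliptic] [V.IsGloballyMinimal] (C : VariableChange ℚ),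
      GoodOrd V 3 → C • V.quadraticTwist ((-1 : ℚ) ^ (3 / 2) * (3 : ℕ)) = W → ¬ (3 : ℤ) ∣ V.frobeniusTrace 3 - 1)
    (hlat : ∃ Φ : AddSubgroup (geomTorsion W (3 : ℤ)), IsRationalLine W 3 Φ ∧ ¬ LineDecompositionTrivialAt W 3 Φ)
    (K : Type) [Field K] [NumberField K] (hdK : NumberField.discr K ≠ -3) :
    AdditiveIMCUpperBDPInputManinAtField W 3 K := by
  have hp2 : (3 : ℕ) ≠ 2 := by norm_num
  have hp2' : 2 < 3 := by norm_num
  have hcase : W.HasGoodOrdinaryReductionOverQuadraticAt 3 :=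
    hasGoodOrdinaryReductionOverQuadraticAt_of_subGordTwo hp2 W hX hSG
  obtain ⟨Φ₀, hΦ₀, -⟩ := id hlat
  have hred : Red W 3 := red_of_isRationalLine hΦ₀
  obtain ⟨W', hE', hmin', C₂, hW, hord, hΔ⟩ :=
    exists_goodOrd_partner_presentation_of_subGordTwo_odd hp2 W hX hSG
  subst hW
  haveI : NeZero (W'.conductorNorm ℤ) := ⟨(WeierstrassCurve.conductorNorm_pos_holds W').ne'⟩
  intro N _ Dt H ι P hr' hloc hN hK hodd hunit hHe hL1 hP hnt htf κ hκ γ _ 𝔭 h𝔭 he hf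
  refine additiveIMCUpperBDPOnTreeLeAt_of_kolyvagin_of_hsieh_of_lzz_of_intCoDivConj hKo hA hL hp2 hX (Or.inr hSG) Dt H ι P
    hr' hloc hN hK hodd hunit hHe hL1 hP hnt κ hκ γ 𝔭 h𝔭 he hf ?_
  intro 𝔮 h𝔮 hne he' hf' ι' hι' ΩK Ωp Q hΩK hΩp hQ
  obtain ⟨Dt'⟩ := hPar W'
  haveI : IsGalois ℚ K := Literature.FieldTheory.Galois.isGalois_of_finrank_eq_two hK.1
  have hpN' : ¬ 3 ∣ W'.conductorNorm ℤ := not_dvd_conductorNorm_of_hasGoodReductionAtPrime W' hord.1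
  have hmodN : exists_isNewformOf := exists_isNewformOf_of_nonempty_modularParametrizationData hPar
  have hHe' : SatisfiesHeegnerHypothesis (W'.conductorNorm ℤ) K :=
    SatisfiesHeegnerHypothesis.of_dvd (conductorNorm_partner_dvd_level hmodN hp2 W' hord.1 _ C₂ Dt) hHe
  -- torsion AND `μ(𝔛) = 0` at `v̄ = 𝔭` for the presented curve itself, from AUX3-NAT (FILE E1) and the NAT index road (FILE D §2) — NO CGLS Prop. 14
  obtain ⟨θsub, θquot, θ₀, θ₀K, Cbar, ΩK₀, Ωp₀, Lφ, nφ, hpair, -, -, -, -, -, -, -, -, hRH⟩ :=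
    NATKYBranchThree.exists_aux3nat_of_thm212 h212 h331 hFE hO1 _ hX hSG htw hN hK hHe hodd hdK hκ γ h𝔭 he hf h𝔮 hne hι'
  obtain ⟨hRHs, -⟩ := hRH θsub (Or.inl rfl)
  obtain ⟨hRHq, -⟩ := hRH θquot (Or.inr rfl)
  obtain ⟨Sf, hSf⟩ := KYBranchThree.exists_finset_primes_over_not_three (K := K) N
  obtain ⟨-, -, -, hT, hμX⟩ := NATLambdaAlgebraicSide.xAc_clauses_of_primitive_clauses _ hp2' hX.2.1 K hK (by rw [hN]; exact hHe)
    (embAt K 3 𝔮 h𝔮 he' hf') 𝔮 𝔭 (fun x ↦ mem_asIdeal_iff_norm_embAt_lt_one 𝔮 h𝔮 he' hf' x) h𝔭 hne κ hκ γ θsub θquot hpair Sf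
    (by rw [hN]; exact hSf)
    (fun D' ↦ ⟨(hRHs D').1, (hRHs D').2.1, (hRHs D').2.2.1⟩) (fun D' ↦ ⟨(hRHq D').1, (hRHq D').2.1, (hRHq D').2.2.1⟩)
  exact span_le_xac_charIdeal_map_of_KY_dvd_of_isTorsion_of_muInvariant_eq_zero hCHσ hdvd hmodN hp2 W' hord.1 _ C₂ Dt Dt' hpN'
    hK hHe hHe' hodd hdK hκ γ h𝔭 he hf h𝔮 hne hι' hN hcase hred hlat htf hT hμX hΩK hΩp hQ

/-! ### §2–§3 The UPPER half per pair at `p = 3`: NAT, and the whole (G-ord, `e = 2`) cell — no CGLS §1.2 binder -/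

/-- **UPPER half per pair on the (G-ord, `e = 2`) cell at `p = 3` under `NAT(W, 3)` ⇐ `PrintedFacts` ∧ Hsieh 2014 Thm. A ∧ LZZ 2018 ∧ Castella–Hsieh signed ∧ [DIV.dvd] ∧
CGLS Thm. 2.1.2 ∧ Bleher et al. 3.3.1 ∧ de Shalit II.6.4 ∧ Hida Thm. I ∧ the pair's twist-unit datum — NO CGLS Prop. 14.**  Generation 25's §4 wrapper with §1 as the
co-socket.  CONDITIONAL; closes no item; BSD not advanced.
[cite: KellerYin2024b, Thm. 3.3.6 and Prop. 3.4.4 (arXiv:2410.23241 p. 19) (preprint; hypothesis)] [cite: JetchevSkinnerWan2017, §7.4.1 (arXiv:1512.06894 p. 30)]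
[cite: CastellaHsieh2018, §3.3, Def. 3.7 and Prop. 3.8] [cite: Miller2011LMS, Def. 1.1] -/
theorem missingUpperBoundAt_gordTwo_three_of_printedFacts_of_twistUnitAt_of_forall_twist_of_aux3nat
    (hF : PrintedFacts) (hA : Hsieh2014.thmA_exists_isHsiehLFunction_unrPeriod_anyLevel)
    (hL : LiuZhangZhang2018.thm151_thm153_modularCurve_heegnerVector_additive)
    (hdvd : thm336_dvd_branch_OPEN) (hCHσ : castellaHsieh2018_exists_isBranchBDPLFunction_signed)
    (h212 : thm212_exists_isKatzLFunction) (h331 : thm331_rubin_exists_katzMeasure₂_pseudoIso_span_eq)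
    (hFE : thmII64_katzMeasure₂_functionalEquation) (hO1 : thmI_mu_katzBranch_reflect_eq_zero) :
    ∀ (W : WeierstrassCurve ℚ) [W.IsElliptic] [W.IsGloballyMinimal],
      W.analyticRank = 1 → ClassX3 W 3 → Additive.SubGordTwo W 3 →
      (∀ (V : WeierstrassCurve ℚ) [V.IsElliptic] [V.IsGloballyMinimal] (C : VariableChange ℚ),
        GoodOrd V 3 → C • V.quadraticTwist ((-1 : ℚ) ^ (3 / 2) * (3 : ℕ)) = W → ¬ (3 : ℤ) ∣ V.frobeniusTrace 3 - 1) →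
      Upper.TwistUnitFieldOffSliverAt W 3 → MissingUpperBoundAt W 3 := by
  obtain ⟨hGZ, hKo, hGZK, hmod, hPar, hCas, hGZ73, -, -, hHP, -, -, -⟩ := hF
  have hCtl := anticycControlAdditiveKF_proof controlFacts_proof.1 controlFacts_proof.2.1 controlFacts_proof.2.2.1
    controlFacts_proof.2.2.2 hKo
  intro W _ _ hr hX hG htw hTU
  have hp2 : (3 : ℕ) ≠ 2 := by norm_num
  have hpN : 3 ∣ W.conductorNorm ℤ := (W.dvd_conductorNorm_iff_not_hasGoodReductionAtPrime 3).mpr hX.2.1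
  exact Upper.missingUpperBoundAt_of_goodMemberCoStepLField_of_twistUnitFieldOffSliver hGZ hKo hGZK hmod hGZ73 hCas hHP W 3 hr hp2
    hpN (fun K _ _ hK _ hpd hdK ↦ UpperOfPrintNonAnomalousTwist.coChainMemberField_gordTwo_of_coIMCFieldAt_isogenous_of_control hKo hPar hCtl
      W 3 hr hp2 hX hG K hK hpd
      fun W₁ _ _ hiso₁ hX₁ hS₁ hlat₁ ↦
        additiveIMCUpperBDPInputManinAtField_three_of_aux3nat hKo hPar hA hL hdvd hCHσ h212 h331 hFE hO1 hX₁ hS₁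
          (UpperOfPrintNonAnomalousTwist.forall_twist_of_isIsogenous hp2 hX hG hiso₁ htw) hlat₁ K hdK) hTU

/-- **UPPER half per pair on the WHOLE (G-ord, `e = 2`) cell at `p = 3` from the TU datum — NO CGLS §1.2 binder** (NAT branch §2; anomalous branch =
`UpperThreeAnomalousOfPartnerClassTree.missingUpperBoundAt_gordTwo_three_of_printedFacts_of_twistUnitAt_of_partnerClass_of_tree`, unchanged).
CONDITIONAL; closes no item; BSD not advanced. [cite: KellerYin2024b, Thm. 3.3.6 and Prop. 3.4.4 (arXiv:2410.23241 p. 19) (preprint; hypothesis)]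
[cite: BleherEtAl2020, §3.3 Thm. 3.3.1] [cite: deShalit1987, II.6.4] [cite: Hida2010MuInvariant, Thm. I] [cite: CastellaGrossiLeeSkinner2022, Thm. 2.1.2] -/
theorem missingUpperBoundAt_gordTwo_three_of_printedFacts_of_twistUnitAt_noCGLS
    (hF : PrintedFacts) (hA : Hsieh2014.thmA_exists_isHsiehLFunction_unrPeriod_anyLevel)
    (hL : LiuZhangZhang2018.thm151_thm153_modularCurve_heegnerVector_additive)
    (hdvd : thm336_dvd_branch_OPEN) (hCHσ : castellaHsieh2018_exists_isBranchBDPLFunction_signed)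
    (h212 : thm212_exists_isKatzLFunction) (h331 : thm331_rubin_exists_katzMeasure₂_pseudoIso_span_eq)
    (hFE : thmII64_katzMeasure₂_functionalEquation) (hO1 : thmI_mu_katzBranch_reflect_eq_zero) :
    ∀ (W : WeierstrassCurve ℚ) [W.IsElliptic] [W.IsGloballyMinimal],
      W.analyticRank = 1 → ClassX3 W 3 → Additive.SubGordTwo W 3 →
      Upper.TwistUnitFieldOffSliverAt W 3 → MissingUpperBoundAt W 3 := by
  intro W _ _ hr hX hG hTU
  rcases forall_twist_not_anomalous_or_exists_anomalous_twist W hX hG with hNAT | ⟨V₀, _, _, C₀, hord₀, hC₀, hanom₀⟩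
  · exact missingUpperBoundAt_gordTwo_three_of_printedFacts_of_twistUnitAt_of_forall_twist_of_aux3nat hF hA hL hdvd hCHσ h212 h331 hFE hO1 W
      hr hX hG hNAT hTU
  · exact UpperThreeAnomalousOfPartnerClassTree.missingUpperBoundAt_gordTwo_three_of_printedFacts_of_twistUnitAt_of_partnerClass_of_tree
      hF hA hL hdvd hCHσ h331 hFE hO1 W hr hX hG (exists_partnerClass_of_anomalous_twist_model hX.1 C₀ hC₀ hord₀ hanom₀) hTU

/-! ### §4 The BOTH-halves per-pair records at `p = 3` with NO CGLS §1.2 statement -/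

/-- **BOTH halves per pair on the WHOLE (G-ord, `e = 2`) cell AT `p = 3` from the TU datum: `MissingPPartAt W 3` — NO CGLS §1.2 statement** (lower = FILE E6
`KYBranchPerPairNAT.missingLowerBoundAt_gordTwo_three`, upper = §3).  CONDITIONAL; closes no item; BSD not advanced. [claim: KellerYin2024PotOrd, status: under-review]
[cite: Miller2011LMS, Def. 1.1] [cite: KellerYin2024b, Thm. 3.3.6, Prop. 3.4.4, Thm. 3.5.1 (arXiv:2410.23241 pp. 19–20) (preprint; hypotheses)]
[cite: CastellaGrossiLeeSkinner2022, Thms. 1.2.2, 2.1.2, 2.2.2] [cite: BleherEtAl2020, §3.3 Thm. 3.3.1] [cite: deShalit1987, II.6.4] [cite: Hida2010MuInvariant, Thm. I] -/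
theorem missingPPartAt_gordTwo_three_of_twistUnitAt (hF : PrintedFacts)
    (hA : Hsieh2014.thmA_exists_isHsiehLFunction_unrPeriod_anyLevel)
    (hL : LiuZhangZhang2018.thm151_thm153_modularCurve_heegnerVector_additive)
    (hCHσ : castellaHsieh2018_exists_isBranchBDPLFunction_signed)
    (hDVD : thm336_dvd_branch_OPEN) (hAN3 : thm351_anacong_branch_three) (hAN : thm351_anacong_branch_three_allTwists)
    (h212 : thm212_exists_isKatzLFunction)
    (h331 : thm331_rubin_exists_katzMeasure₂_pseudoIso_span_eq)
    (hFE : thmII64_katzMeasure₂_functionalEquation) (hO1 : thmI_mu_katzBranch_reflect_eq_zero) :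
    ∀ (W : WeierstrassCurve ℚ) [W.IsElliptic] [W.IsGloballyMinimal],
      W.analyticRank = 1 → ClassX3 W 3 → Additive.SubGordTwo W 3 → Upper.TwistUnitFieldOffSliverAt W 3 → MissingPPartAt W 3 :=
  fun W _ _ hr hX hG hTU =>
    missingPPartAt_of_lower_of_upper W 3
      (KYBranchPerPairNAT.missingLowerBoundAt_gordTwo_three hF hA hL hCHσ hDVD hAN3 hAN h212 h331 hFE hO1 W hr hX hG)
      (missingUpperBoundAt_gordTwo_three_of_printedFacts_of_twistUnitAt_noCGLS hF hA hL hDVD hCHσ h212 h331 hFE hO1 W hr hX hG hTU)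

/-- **Miller's `BSD(E, 3)` per pair on the WHOLE (G-ord, `e = 2`) cell from the TU datum — NO CGLS §1.2 statement.**  NOT a proof of BSD for any curve: BSD₃ MODULO
{published theorems: Kolyvagin, GZ, BCDT, Hsieh A, LZZ, Castella–Hsieh signed, CGLS Thm 2.1.2, Bleher et al. 3.3.1, de Shalit II.6.4, Hida Thm I} ∪ {[DIV.dvd], the analytic
counts (PREPRINT)} ∪ {the pair's TU certificate}. [claim: KellerYin2024PotOrd, status: under-review] [cite: Miller2011LMS, §1 and Def. 1.1]
[cite: KellerYin2024b, Thm. 3.3.6 and Prop. 3.4.4 (arXiv:2410.23241 p. 19) (preprint; hypothesis)] -/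
theorem bsdp_gordTwo_three_of_twistUnitAt (hF : PrintedFacts)
    (hA : Hsieh2014.thmA_exists_isHsiehLFunction_unrPeriod_anyLevel)
    (hL : LiuZhangZhang2018.thm151_thm153_modularCurve_heegnerVector_additive)
    (hCHσ : castellaHsieh2018_exists_isBranchBDPLFunction_signed)
    (hDVD : thm336_dvd_branch_OPEN) (hAN3 : thm351_anacong_branch_three) (hAN : thm351_anacong_branch_three_allTwists)
    (h212 : thm212_exists_isKatzLFunction)
    (h331 : thm331_rubin_exists_katzMeasure₂_pseudoIso_span_eq)
    (hFE : thmII64_katzMeasure₂_functionalEquation) (hO1 : thmI_mu_katzBranch_reflect_eq_zero) :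
    ∀ (W : WeierstrassCurve ℚ) [W.IsElliptic] [W.IsGloballyMinimal],
      W.analyticRank = 1 → ClassX3 W 3 → Additive.SubGordTwo W 3 → Upper.TwistUnitFieldOffSliverAt W 3 → BSDp W 3 :=
  fun W _ _ hr hX hG hTU =>
    bsdp_of_missingPPartAt W 3 hF.2.2.1 (le_of_eq hr)
      (missingPPartAt_gordTwo_three_of_twistUnitAt hF hA hL hCHσ hDVD hAN3 hAN h212 h331 hFE hO1 W hr hX hG hTU)

end Summit.BirchSwinnertonDyer.BirchSwinnertonDyer.Theorems.SchneiderFreeAdditiveX3.UpperGordCellThreeNAT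

end
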